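import Mathlib
import HarnessLib
import Summits.AtomisticToContinuum.Crystallization.Theorems.PricedLinkCensusSoftFourRingsCapEndgame
import Summits.AtomisticToContinuum.Crystallization.Theorems.PricedLinkCensusSoftFourRingsDefs
import Summits.AtomisticToContinuum.Crystallization.Theorems.PricedLinkCensusSoftFourRingsCapAssembly
import Summits.AtomisticToContinuum.Crystallization.Theorems.PricedLinkCensusSoftFourRingsEndgameReduction

/-!
# Soft four-rings: `EndgameRigidity` from `LabelledRigidity` — `Cap` variant

Route `PricedLinkCensus`, sub-problem `Crystallization`, item `SoftFourRings`
(stmt-AtomisticToContinuum-14234).  `Cap` variant (seat c3) of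
`PricedLinkCensusSoftFourRingsEndgameReduction`: with the combinatorial endgame
`Cap.bond_graph_fcc_or_hcp` (local covering hypothesis) in hand,

* `endgameRigidity_of_labelledRigidity : (bond-to-cap) → LabelledRigidity δ → EndgameRigidity δ`;
* `softFourRings_of_labelledRigidity : (bond-to-cap) → δ ≤ 6/25 → LabelledRigidity δ → SoftFourRings`,

where "(bond-to-cap)" is the inline hypothesis of `Cap.softFourRings_of_endgameRigidity` (every
unit vector is within chordal distance `0.957` of one of the twelve directions of a hull-level
setting).  `LabelledRigidity (6/25)` is PROVED in the tree (`Rig.labelledRigidity_holds`).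
-/

namespace Summit.AtomisticToContinuum.Crystallization.Theorems.Cap

open Real RealInnerProductSpace Literature.Geometry.DiscreteGeometry

/-- **`EndgameRigidity` from the bond-to-cap implication and labelled rigidity.** -/
theorem endgameRigidity_of_labelledRigidity
    (hC : ∀ (X : Finset (EuclideanSpace ℝ (Fin 3))) (B : Finset (Finset (EuclideanSpace ℝ (Fin 3)))),
      (∀ y ∈ X, ‖y‖ = 1) → X.card = 12 →
      (∀ u ∈ X, ∀ u' ∈ X, u ≠ u' → ⟪u, u'⟫ ≤ 1 - 1 / (2 * (101 / 100 : ℝ) ^ 2)) →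
      (∀ T ∈ B, ∃ u ∈ X, ∃ u' ∈ X, u ≠ u' ∧ 1 - (101 / 100 : ℝ) ^ 2 / 2 ≤ ⟪u, u'⟫ ∧
        T = {u, u'}) →
      B.card = 24 →
      (∀ v ∈ X, ∃ w : Fin 4 → EuclideanSpace ℝ (Fin 3), (∀ k, w k ∈ X) ∧
        Function.Injective w ∧ (∀ k, w k ≠ v) ∧
        (∀ k, ({v, w k} : Finset (EuclideanSpace ℝ (Fin 3))) ∈ B) ∧
        ∀ y, ({v, y} : Finset (EuclideanSpace ℝ (Fin 3))) ∈ B → ∃ k, y = w k) →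
      (∀ u ∈ X, ∀ u' ∈ X, u ≠ u' → ({u, u'} : Finset (EuclideanSpace ℝ (Fin 3))) ∉ B →
        ⟪u, u'⟫ < 101 / 200) →
      ∀ p : EuclideanSpace ℝ (Fin 3), ‖p‖ = 1 → ∃ x ∈ X, dist p x < 0.957)
    {δ : ℝ} (hLR : LabelledRigidity δ) : EndgameRigidity δ := by
  intro X B hX1 hcard hsepX hB hBcard hdeg hnonbond _h0 _h34 _hT8 _ht2
  have hT : ∀ p : EuclideanSpace ℝ (Fin 3), ‖p‖ = 1 → ∃ x ∈ X, dist p x < 0.957 :=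
    hC X B hX1 hcard hsepX hB hBcard hdeg hnonbond
  obtain ⟨p, hinj, hpX, hgraph⟩ := bond_graph_fcc_or_hcp hT hX1 hcard hsepX hB hBcard hdeg
  have hp1 : ∀ i, ‖p i‖ = 1 := fun i => hX1 _ (hpX i)
  have hsep : ∀ i j, i ≠ j → ⟪p i, p j⟫ ≤ 1 - 1 / (2 * (101 / 100 : ℝ) ^ 2) :=
    fun i j hij => hsepX _ (hpX i) _ (hpX j) (hinj.ne hij)
  rcases hgraph with hg | hg
  · have hbond : ∀ i j, fccAdj i j → 1 - (101 / 100 : ℝ) ^ 2 / 2 ≤ ⟪p i, p j⟫ := by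
      intro i j h
      have hmem := (hg i j).2 h
      exact (close_of_pair_mem_bonds hB hmem (ne_of_mem_bonds hB hmem)).2.2
    have hnb : ∀ i j, i ≠ j → ¬ fccAdj i j → ⟪p i, p j⟫ < 101 / 200 :=
      fun i j hij hadj => hnonbond _ (hpX i) _ (hpX j) (hinj.ne hij) (mt (hg i j).1 hadj)
    obtain ⟨A, hA⟩ := hLR.1 p hp1 hsep hbond hnb
    refine ⟨A, fccKissingPattern, Or.inl rfl, fun q hq => ?_⟩
    obtain ⟨i, hi⟩ := hA q hq
    exact ⟨p i, hpX i, hi⟩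
  · have hbond : ∀ i j, hcpAdj i j → 1 - (101 / 100 : ℝ) ^ 2 / 2 ≤ ⟪p i, p j⟫ := by
      intro i j h
      have hmem := (hg i j).2 h
      exact (close_of_pair_mem_bonds hB hmem (ne_of_mem_bonds hB hmem)).2.2
    have hnb : ∀ i j, i ≠ j → ¬ hcpAdj i j → ⟪p i, p j⟫ < 101 / 200 :=
      fun i j hij hadj => hnonbond _ (hpX i) _ (hpX j) (hinj.ne hij) (mt (hg i j).1 hadj)
    obtain ⟨A, hA⟩ := hLR.2 p hp1 hsep hbond hnb
    refine ⟨A, hcpKissingPattern, Or.inr rfl, fun q hq => ?_⟩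
    obtain ⟨i, hi⟩ := hA q hq
    exact ⟨p i, hpX i, hi⟩

/-- **`SoftFourRings` modulo the bond-to-cap implication and labelled (metric) rigidity.** -/
theorem softFourRings_of_labelledRigidity
    (hC : ∀ (X : Finset (EuclideanSpace ℝ (Fin 3))) (B : Finset (Finset (EuclideanSpace ℝ (Fin 3)))),
      (∀ y ∈ X, ‖y‖ = 1) → X.card = 12 →
      (∀ u ∈ X, ∀ u' ∈ X, u ≠ u' → ⟪u, u'⟫ ≤ 1 - 1 / (2 * (101 / 100 : ℝ) ^ 2)) →
      (∀ T ∈ B, ∃ u ∈ X, ∃ u' ∈ X, u ≠ u' ∧ 1 - (101 / 100 : ℝ) ^ 2 / 2 ≤ ⟪u, u'⟫ ∧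
        T = {u, u'}) →
      B.card = 24 →
      (∀ v ∈ X, ∃ w : Fin 4 → EuclideanSpace ℝ (Fin 3), (∀ k, w k ∈ X) ∧
        Function.Injective w ∧ (∀ k, w k ≠ v) ∧
        (∀ k, ({v, w k} : Finset (EuclideanSpace ℝ (Fin 3))) ∈ B) ∧
        ∀ y, ({v, y} : Finset (EuclideanSpace ℝ (Fin 3))) ∈ B → ∃ k, y = w k) →
      (∀ u ∈ X, ∀ u' ∈ X, u ≠ u' → ({u, u'} : Finset (EuclideanSpace ℝ (Fin 3))) ∉ B →
        ⟪u, u'⟫ < 101 / 200) →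
      ∀ p : EuclideanSpace ℝ (Fin 3), ‖p‖ = 1 → ∃ x ∈ X, dist p x < 0.957)
    {δ : ℝ} (hδ : δ ≤ 6 / 25) (hLR : LabelledRigidity δ) :
    Summit.AtomisticToContinuum.Crystallization.Theses.PricedLinkCensus.SoftFourRings :=
  softFourRings_of_endgameRigidity hC hδ (endgameRigidity_of_labelledRigidity hC hLR)

end Summit.AtomisticToContinuum.Crystallization.Theorems.Cap
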